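import Literature.NumberTheory.EllipticCurves.GreenbergVatsal2000.NonPrimitivePAdicLFunction
import Literature.NumberTheory.EllipticCurves.HasseWeilGoodReductionFrobenius
import Literature.NumberTheory.EllipticCurves.LFunctionPrimeCoeff
import HarnessLib

/-!
# The depletion factor of Matsuno's Lemma 3.3 vs Greenberg–Vatsal's Euler-factor element `𝒫_ℓ(T)`:
# `ℓ · 𝒫_ℓ = (ℓ − 1) − (1+T)^{f_ℓ} · (a_ℓ − (1+T)^{−f_ℓ} − (1+T)^{f_ℓ})` in `Λ = ℤ_p⟦T⟧`, and the exponent `f_ℓ`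
# at the finite levels `ℤ/p^{n+e₀}` (PROOFS ONLY)

Cell bsd-2adic, seat conv-1 (planner RULING RC-159; the bookkeeping between the two currencies of the congruence `hcong`).
Matsuno's Lemma 3.3 (J. Number Theory 84 (2000), pp. 87–88) depletes at a good prime `ℓ` by the factor
`h_ℓ = a_ℓ − σ_ℓ⁻¹ − σ_ℓ` (tree: `padicLCoeffTame_mul_prime`, with `σ_ℓ = (1+T)^{c}`, `ℓ ≡ η_ℓ γ^{c mod pⁿ} (mod p^{n+e₀})`
for all `n`), whereas the cell's `λ`-bookkeeping (Greenberg–Vatsal 2000 §1 p. 9, Prop. (2.4)) uses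
`𝒫_ℓ = P_ℓ(ℓ⁻¹(1+T)^{f_ℓ})` (`GreenbergVatsal2000.eulerFactorElement`) with `γ_cyc^{f_ℓ} = ⟨ℓ⟩`
(`frobeniusExponent p ℓ = CyclotomicZp.ell p ℓ`). This file proves:

* §1 `toZModPow_cycPow` — the finite levels of `γ_cyc^x`: `γ_cyc^x ≡ γ^{x mod pⁿ} (mod p^{n+e₀})` (`γ = 1 + p^{e₀}` has order
  `pⁿ` modulo `p^{n+e₀}`; `(1+q)^{pⁿy} ≡ 1 (mod p^{n}q)`, Serre, *Cours d'arithmétique* II.3.2);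
* §2 `exists_rootsOfUnity_mul_cycPow_ell_eq`, `exists_teichmuller_frobeniusExponent` — `u = ω(u) γ_cyc^{ℓ(u)}` with
  `ω(u) ∈ μ_t(ℤ_p)`, hence the Teichmüller–exponent datum of `padicLCoeffTame_mul_prime` holds with `c = f_ℓ`:
  `ℓ ≡ ω(ℓ) γ^{f_ℓ mod pⁿ} (mod p^{n+e₀})` for every `n`;
* §3 `natCast_mul_eulerFactorElement_of_hasGoodReductionAt` — at a place `v` of good reduction with `ℓ = ℓ_v ≠ p`:
  `C ℓ · 𝒫_ℓ = C(ℓ − 1) − (1+T)^{f_ℓ} · (C a_ℓ − (1+T)^{−f_ℓ} − (1+T)^{f_ℓ})` in `Λ` (`P_ℓ = 1 − a_ℓ X + ℓ X²`,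
  `localPolynomialAt_of_hasGoodReductionAt`), and at `p = 2`, `ℓ` odd, `map_toZMod_eulerFactorElement_two_eq`:
  `𝒫_ℓ ≡ −(1+T)^{f_ℓ} · h_ℓ (mod 2)` — Matsuno's factor and Greenberg–Vatsal's agree mod `2` up to the unit `−(1+T)^{f_ℓ}`.

References: K. Matsuno, J. Number Theory 84 (2000), Lemma 3.3 (pp. 87–88) [Matsuno2000]; R. Greenberg, V. Vatsal, Invent.
Math. 142 (2000), §1 p. 9, §2 Prop. (2.4) [GreenbergVatsal2000]; J.-P. Serre, *A Course in Arithmetic*, Ch. II §3.2 [Serre1973].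
-/

noncomputable section

open scoped Classical

open NumberField IsDedekindDomain WeierstrassCurve Polynomial
  Literature.NumberTheory.EllipticCurves.CyclotomicZp Literature.NumberTheory.EllipticCurves.PadicOneUnits
  Literature.NumberTheory.EllipticCurves.GreenbergVatsal2000

namespace Literature.NumberTheory.EllipticCurves

/-! ### §1. The finite levels of `γ_cyc^x` -/

section Levels

variable (p : ℕ) [Fact p.Prime]

/-- **`γ_cyc^x ≡ γ^{x mod pⁿ} (mod p^{n+e₀})`**: the reduction of `cycPow p x = γ_cyc^x` modulo `p^{n+e₀}` is the
`(x mod pⁿ)`-th power of `γ = 1 + p^{e₀}` (write `x = k + pⁿy`, `γ_cyc^k = γ^k`, and `‖γ_cyc^{pⁿy} − 1‖ = ‖pⁿy‖·‖p^{e₀}‖`,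
`norm_oneAddPow_sub_one`). [cite: Serre1973, Ch. II §3.2 Prop. 8] -/
theorem toZModPow_cycPow (x : ℤ_[p]) (n : ℕ) :
    PadicInt.toZModPow (n + cyclotomicExponent p) (cycPow p x) =
      (cyclotomicGenerator p : ZMod (p ^ (n + cyclotomicExponent p))) ^ (PadicInt.toZModPow n x).val := by
  haveI : NeZero (p ^ n) := ⟨pow_ne_zero _ (Fact.out : p.Prime).ne_zero⟩
  obtain ⟨k, hk⟩ : ∃ k : ℕ, (PadicInt.toZModPow n x).val = k := ⟨_, rfl⟩
  have hmem : x - (k : ℤ_[p]) ∈ Ideal.span {(p : ℤ_[p]) ^ n} := by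
    rw [← PadicInt.ker_toZModPow, RingHom.mem_ker, map_sub, map_natCast, ← hk, ZMod.natCast_zmod_val, sub_self]
  obtain ⟨y, hy⟩ := Ideal.mem_span_singleton'.mp hmem
  have hx : x = (k : ℤ_[p]) + y * (p : ℤ_[p]) ^ n := by rw [hy]; ring
  have h1 : cycPow p (k : ℤ_[p]) = (cyclotomicGenerator p : ℤ_[p]) ^ k := by
    rw [show (k : ℤ_[p]) = k • (1 : ℤ_[p]) by simp, AddChar.map_nsmul_eq_pow, cycPow_one]
  have h2 : PadicInt.toZModPow (n + cyclotomicExponent p) (cycPow p (y * (p : ℤ_[p]) ^ n)) = 1 := by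
    have hnorm : ‖cycPow p (y * (p : ℤ_[p]) ^ n) - 1‖ ≤ ‖(p : ℤ_[p]) ^ (n + cyclotomicExponent p)‖ := by
      rw [cycPow, norm_oneAddPow_sub_one _ (cyclotomicExponent_cond p), ← cyclotomicExponent_eq_succ, ← norm_mul,
        mul_assoc, ← pow_add, norm_mul]
      calc ‖y‖ * ‖(p : ℤ_[p]) ^ (n + cyclotomicExponent p)‖
          ≤ 1 * ‖(p : ℤ_[p]) ^ (n + cyclotomicExponent p)‖ := by gcongr; exact y.norm_le_one
        _ = _ := one_mul _
    rw [PadicInt.norm_p_pow, PadicInt.norm_le_pow_iff_mem_span_pow, ← PadicInt.ker_toZModPow, RingHom.mem_ker,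
      map_sub, map_one, sub_eq_zero] at hnorm
    exact hnorm
  rw [hk, hx, AddChar.map_add_eq_mul, map_mul, h2, mul_one, h1, map_pow, map_natCast]

end Levels

/-! ### §2. `u = ω(u) · γ_cyc^{ℓ(u)}` and the Teichmüller–exponent datum of a prime `ℓ ≠ p` -/

section Teichmuller

variable (p : ℕ) [Fact p.Prime]

/-- **`u = ω(u) γ_cyc^{ℓ(u)}`**: every unit of `ℤ_p` is a root of unity of order dividing `t = #μ(ℤ_p)` times
`γ_cyc^{ℓ(u)}`, `ℓ = CyclotomicZp.ell` the normalised logarithm (`γ_cyc^{t ℓ(u)} = u^t`, `cycPow_torsionOrder_mul_ell`):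
`ω(u) := u · γ_cyc^{−ℓ(u)}` has `ω(u)^t = u^t / γ_cyc^{tℓ(u)} = 1`. (Serre, *A Course in Arithmetic* II.3.2: `ℤ_pˣ = V × U`.)
[cite: Serre1973, Ch. II §3.2 Prop. 8] -/
theorem exists_rootsOfUnity_mul_cycPow_ell_eq (u : ℤ_[p]ˣ) :
    ∃ teich : rootsOfUnity (torsionOrder p) ℤ_[p], ((teich : ℤ_[p]ˣ) : ℤ_[p]) * cycPow p (ell p u) = u := by
  have hct : cycPowUnit p (ell p u) ^ torsionOrder p = u ^ torsionOrder p := by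
    ext
    rw [Units.val_pow_eq_pow_val, Units.val_pow_eq_pow_val, val_cycPowUnit, ← AddChar.map_nsmul_eq_pow,
      nsmul_eq_mul, cycPow_torsionOrder_mul_ell]
  refine ⟨⟨u * (cycPowUnit p (ell p u))⁻¹, ?_⟩, ?_⟩
  · rw [mem_rootsOfUnity, mul_pow, inv_pow, hct, mul_inv_cancel]
  · simp only
    rw [← val_cycPowUnit, ← Units.val_mul, inv_mul_cancel_right]

/-- The finite levels of `u = ω(u) γ_cyc^{ℓ(u)}`: `u ≡ ω(u) γ^{ℓ(u) mod pⁿ} (mod p^{n+e₀})` for every `n`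
(`toZModPow_cycPow`). [cite: Serre1973, Ch. II §3.2 Prop. 8] -/
theorem exists_rootsOfUnity_toZModPow_eq (u : ℤ_[p]ˣ) :
    ∃ teich : rootsOfUnity (torsionOrder p) ℤ_[p], ∀ n : ℕ,
      PadicInt.toZModPow (n + cyclotomicExponent p) ((teich : ℤ_[p]ˣ) : ℤ_[p]) *
        (cyclotomicGenerator p : ZMod (p ^ (n + cyclotomicExponent p))) ^ (PadicInt.toZModPow n (ell p u)).val =
          PadicInt.toZModPow (n + cyclotomicExponent p) (u : ℤ_[p]) := by
  obtain ⟨teich, hteich⟩ := exists_rootsOfUnity_mul_cycPow_ell_eq p u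
  exact ⟨teich, fun n ↦ by rw [← toZModPow_cycPow, ← map_mul, hteich]⟩

/-- A natural number prime to `p` is a unit of `ℤ_p`. [folklore] -/
private theorem isUnit_natCast_padicInt_of_coprime {ℓ : ℕ} (hℓp : ℓ.Coprime p) : IsUnit (ℓ : ℤ_[p]) := by
  rw [PadicInt.isUnit_iff]
  refine le_antisymm (PadicInt.norm_le_one _) (not_lt.mp fun h ↦ ?_)
  have h' : ‖((ℓ : ℤ) : ℤ_[p])‖ < 1 := by rwa [Int.cast_natCast]
  rw [PadicInt.norm_int_lt_one_iff_dvd, Int.natCast_dvd_natCast] at h'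
  exact (Nat.Prime.coprime_iff_not_dvd Fact.out).mp hℓp.symm h'

/-- **The Teichmüller–exponent datum of `ℓ` with Greenberg–Vatsal's exponent `f_ℓ`**: for `ℓ` prime to `p` there is
`ω(ℓ) ∈ μ_t(ℤ_p)` with `ℓ ≡ ω(ℓ) γ^{f_ℓ mod pⁿ} (mod p^{n+e₀})` for every `n`, `f_ℓ = frobeniusExponent p ℓ` (`γ_cyc^{f_ℓ} = ⟨ℓ⟩`,
GV p. 9: "`f_ℓ ∈ ℤ_p` is determined by `γ^{f_ℓ} = γ_ℓ`") — i.e. the hypothesis `hc` of `padicLCoeffTame_mul_prime` holds with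
`c = f_ℓ`. [cite: GreenbergVatsal2000, §1 p. 9 (definition of f_ℓ)] -/
theorem exists_teichmuller_frobeniusExponent {ℓ : ℕ} (hℓp : ℓ.Coprime p) :
    ∃ teich : rootsOfUnity (torsionOrder p) ℤ_[p], ∀ n : ℕ,
      PadicInt.toZModPow (n + cyclotomicExponent p) ((teich : ℤ_[p]ˣ) : ℤ_[p]) *
        (cyclotomicGenerator p : ZMod (p ^ (n + cyclotomicExponent p))) ^
          (PadicInt.toZModPow n (frobeniusExponent p (ℓ : ℤ_[p]))).val =
          (ℓ : ZMod (p ^ (n + cyclotomicExponent p))) := by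
  have hu := isUnit_natCast_padicInt_of_coprime p hℓp
  obtain ⟨teich, hteich⟩ := exists_rootsOfUnity_toZModPow_eq p hu.unit
  refine ⟨teich, fun n ↦ ?_⟩
  rw [frobeniusExponent_of_isUnit hu, hteich n, IsUnit.unit_spec, map_natCast]

end Teichmuller

/-! ### §3. `ℓ · 𝒫_ℓ = (ℓ − 1) − (1+T)^{f_ℓ} · h_ℓ` at a good place, and `𝒫_ℓ ≡ −(1+T)^{f_ℓ} h_ℓ (mod 2)` -/

section EulerFactor

variable (W : WeierstrassCurve ℚ) (p : ℕ) [Fact p.Prime] (v : HeightOneSpectrum (𝓞 ℚ))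

/-- `(1+T)^{c} · (1+T)^{−c} = 1` in `Λ` (Mathlib `binomialSeries_add`, `binomialSeries_zero`). [folklore] -/
private theorem binomialSeries_mul_neg (c : ℤ_[p]) :
    PowerSeries.binomialSeries ℤ_[p] c * PowerSeries.binomialSeries ℤ_[p] (-c) = 1 := by
  rw [← PowerSeries.binomialSeries_add, add_neg_cancel, PowerSeries.binomialSeries_zero]

/-- **Matsuno's depletion factor vs Greenberg–Vatsal's `𝒫_ℓ`, exactly, in `Λ = ℤ_p⟦T⟧`**: at a place `v` of good reduction
with `ℓ = ℓ_v ≠ p`, `a_ℓ = W.frobeniusTraceAt v`, `f_ℓ = frobeniusExponent p ℓ`, `B = (1+T)^{f_ℓ} = frobeniusSeries p ℓ`: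
`C ℓ · 𝒫_ℓ = C (ℓ − 1) − B · (C a_ℓ − (1+T)^{−f_ℓ} − B)` (`𝒫_ℓ = P_ℓ(ℓ⁻¹B) = 1 − a_ℓ ℓ⁻¹ B + ℓ⁻¹ B²`,
`localPolynomialAt_of_hasGoodReductionAt`, `ℓ · ℓ⁻¹ = 1`). [cite: GreenbergVatsal2000, §1 pp. 8–9 and §2 Prop. (2.4) (𝒫_ℓ = P_ℓ(ℓ⁻¹γ_ℓ))]
[cite: Matsuno2000, Lemma 3.3 (pp. 87–88)] -/
theorem natCast_mul_eulerFactorElement_of_hasGoodReductionAt (hv : W.HasGoodReductionAt v)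
    (hℓp : (Rat.HeightOneSpectrum.natGenerator v).Coprime p) :
    PowerSeries.C (Rat.HeightOneSpectrum.natGenerator v : ℤ_[p]) * eulerFactorElement W p v =
      PowerSeries.C ((Rat.HeightOneSpectrum.natGenerator v : ℤ_[p]) - 1) -
        frobeniusSeries p (Rat.HeightOneSpectrum.natGenerator v) *
          (PowerSeries.C ((W.frobeniusTraceAt v : ℤ) : ℤ_[p]) -
            PowerSeries.binomialSeries ℤ_[p] (-frobeniusExponent p (Rat.HeightOneSpectrum.natGenerator v : ℤ_[p])) -
            frobeniusSeries p (Rat.HeightOneSpectrum.natGenerator v)) := by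
  have hq : (Nat.card (IsLocalRing.ResidueField (v.adicCompletionIntegers ℚ)) : ℤ) =
      ((Rat.HeightOneSpectrum.natGenerator v : ℕ) : ℤ) := by
    rw [natCard_residueField_adicCompletionIntegers]; rfl
  have hinv : PowerSeries.C (Rat.HeightOneSpectrum.natGenerator v : ℤ_[p]) *
      PowerSeries.C ((Rat.HeightOneSpectrum.natGenerator v : ℤ_[p]).inv) = 1 := by
    rw [← map_mul, PadicInt.mul_inv (PadicInt.isUnit_iff.mp (isUnit_natCast_padicInt_of_coprime p hℓp)), map_one]
  have hBB : frobeniusSeries p (Rat.HeightOneSpectrum.natGenerator v) *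
      PowerSeries.binomialSeries ℤ_[p] (-frobeniusExponent p (Rat.HeightOneSpectrum.natGenerator v : ℤ_[p])) = 1 := by
    rw [frobeniusSeries_eq]; exact binomialSeries_mul_neg p _
  have hP : eulerFactorElement W p v =
      1 - PowerSeries.C ((W.frobeniusTraceAt v : ℤ) : ℤ_[p]) *
          (PowerSeries.C ((Rat.HeightOneSpectrum.natGenerator v : ℤ_[p]).inv) *
            frobeniusSeries p (Rat.HeightOneSpectrum.natGenerator v)) +
        PowerSeries.C (Rat.HeightOneSpectrum.natGenerator v : ℤ_[p]) *
          (PowerSeries.C ((Rat.HeightOneSpectrum.natGenerator v : ℤ_[p]).inv) *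
            frobeniusSeries p (Rat.HeightOneSpectrum.natGenerator v)) ^ 2 := by
    rw [eulerFactorElement, eulerFactorPoint, localPolynomialAt_of_hasGoodReductionAt hv, hq]
    simp only [map_add, map_sub, map_one, map_mul, map_pow, Polynomial.aeval_C, Polynomial.aeval_X]
    rw [eq_intCast, eq_intCast, Int.cast_natCast, ← map_intCast (PowerSeries.C (R := ℤ_[p])),
      ← map_natCast (PowerSeries.C (R := ℤ_[p]))]
  rw [hP, map_sub, map_one]
  linear_combination (-(PowerSeries.C ((W.frobeniusTraceAt v : ℤ) : ℤ_[p])) *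
      frobeniusSeries p (Rat.HeightOneSpectrum.natGenerator v) +
    (PowerSeries.C (Rat.HeightOneSpectrum.natGenerator v : ℤ_[p]) *
        PowerSeries.C ((Rat.HeightOneSpectrum.natGenerator v : ℤ_[p]).inv) + 1) *
      frobeniusSeries p (Rat.HeightOneSpectrum.natGenerator v) ^ 2) * hinv - hBB

/-- **At `p = 2`, `ℓ` odd: `𝒫_ℓ ≡ −(1+T)^{f_ℓ} · h_ℓ (mod 2)`**, `h_ℓ = C a_ℓ − (1+T)^{−f_ℓ} − (1+T)^{f_ℓ}` Matsuno's depletion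
factor — reduce `natCast_mul_eulerFactorElement_of_hasGoodReductionAt` modulo `2` (`ℓ ≡ 1`, `ℓ − 1 ≡ 0`). So Matsuno's
`∏_ℓ h_ℓ` and Greenberg–Vatsal's `∏_ℓ 𝒫_ℓ` have the same image in `𝔽₂⟦T⟧` up to the unit `∏_ℓ (−(1+T)^{f_ℓ})`.
[cite: GreenbergVatsal2000, §2 Prop. (2.4) (p. 22)] [cite: Matsuno2000, Lemma 3.3 (pp. 87–88)] -/
theorem map_toZMod_eulerFactorElement_two_eq (hv : W.HasGoodReductionAt v)
    (hℓ2 : (Rat.HeightOneSpectrum.natGenerator v).Coprime 2) :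
    PowerSeries.map (PadicInt.toZMod (p := 2)) (eulerFactorElement W 2 v) =
      PowerSeries.map (PadicInt.toZMod (p := 2))
        (-frobeniusSeries 2 (Rat.HeightOneSpectrum.natGenerator v) *
          (PowerSeries.C ((W.frobeniusTraceAt v : ℤ) : ℤ_[2]) -
            PowerSeries.binomialSeries ℤ_[2] (-frobeniusExponent 2 (Rat.HeightOneSpectrum.natGenerator v : ℤ_[2])) -
            frobeniusSeries 2 (Rat.HeightOneSpectrum.natGenerator v))) := by
  have h := congrArg (PowerSeries.map (PadicInt.toZMod (p := 2)))
    (natCast_mul_eulerFactorElement_of_hasGoodReductionAt W 2 v hv hℓ2)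
  have hℓ1 : PadicInt.toZMod (p := 2) (Rat.HeightOneSpectrum.natGenerator v : ℤ_[2]) = 1 := by
    rw [map_natCast, ZMod.natCast_eq_one_iff_odd]
    exact Nat.coprime_two_left.mp hℓ2.symm
  rw [map_mul, PowerSeries.map_C, hℓ1, map_one, one_mul, map_sub, PowerSeries.map_C, map_sub, hℓ1, map_one,
    sub_self, map_zero, zero_sub, ← map_neg] at h
  rw [neg_mul]
  exact h

end EulerFactor

end Literature.NumberTheory.EllipticCurves

end
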